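import Literature.Geometry.Riemannian.HamiltonCurvatureODE
import HarnessLib

/-!
# Negative lemma for crux `ChangGurskyYang` (stmt-SmoothPoincare4-10834), line
# `margerin-cone-hamilton-rails`, STUB 1 `stub_margerinPolynomial`: the margin `σ(c)` is bounded by
# `2(1 - √(6c))²/(3 + 6c)` — it vanishes (quadratically) at `c = 1/6` — and NO version holds above `1/6`

Refuter drefute (refuter-drefute-stmt-SmoothPoincare4-10834-0), TIGHTNESS facts for the lead's stub
(`Cruxes/ChangGurskyYang/Lines/margerin-cone-hamilton-rails.lean`, `stub_margerinPolynomial`):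
for `0 ≤ c < 1/6` the stub asks for `σ ∈ (0, 1]` with Margerin's fundamental polynomial
`P₂(p) ≤ -σ·|𝒟|²(p)·R'(p)` on the weak-pinching cone `margerinCone c` (Bianchi locus, `R ≥ 0`,
`|𝒟|² ≤ c R²`) of Hamilton's ODE `(A, B, C)' = (A² + BBᵀ + 2A^#, AB + BC + 2B^#, C² + BᵀB + 2C^#)`
(`Literature.Geometry.Riemannian.HamiltonODE.field`). Along the `S³ × ℝ` family
`p_t = (1, t·1, 1)` (`R = 6`, `|𝒟|² = 6t²`, weak pinching `t²/6`, the round cylinder at `t = 1`) one has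
EXACTLY `field p_t = ((3 + t²)·1, (2t + 2t²)·1, (3 + t²)·1)`, `R' = 18 + 6t²` and
`P₂(p_t) = -72 t² (1 - t)²` (a DOUBLE zero at the cylinder), whence:

* `margerinMargin_le` — if the stub's inequality holds with margin `σ` on the cone of opening
  `c = t²/6`, `t > 0`, then `σ ≤ 2(1 - t)²/(3 + t²)` (for `t ≤ 1` these are the sub-cones of
  the stub; the witness lies ON the boundary `WP = c`); in particular
* `margerinMargin_lt_twoThirds` — `σ < 2/3` on every cone `c > 0` (so the stub's `σ ≤ 1` is never
  the binding constraint), and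
* `no_margerinMargin_at_sixth` — on the closed sharp cone `c = 1/6` NO positive margin exists
  (`P₂ = 0 < |𝒟|²R' = 144` at the cylinder): the stub cannot be extended to `c = 1/6`, and any
  certificate for `c < 1/6` must cope with `σ(c) = O((1 - √(6c))²)`.

Along the Fubini–Study family `q_s = (diag(1+2s, 1−s, 1−s), 0, 1)` (weak pinching `s²/6`, `(ℂP², g_FS)`
at `s = 1`) one has `field q_s = (diag(3+6s², 3−3s², 3−3s²), 0, 3·1)` and `P₂(q_s) = 216 s²(s−1)`
(a TRANSVERSAL zero), whence:

* `margerinP2_pos_above_sixth` — for every `c > 1/6` the cone `WP ≤ c` contains a point with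
  `P₂ > 0` (`s = 12c/(1+6c) ∈ (1, √(6c)]`): weak pinching increases there along the ODE, and
* `no_margerinMargin_above_sixth` — the stub's inequality fails for every `c > 1/6`, `σ ≥ 0`: the
  restriction `c < 1/6` is sharp on the nose (the pointwise shadow of "Theorem A is sharp",
  CGY 2003 p. 106, and of Margerin's Thm. 2).

An adversarial search (refuter folder `local/search_pure.py`; kit j012728) finds the slice maxima
`sup {P₂ : WP = w, R = 6} = -432 w (1 - √(6w))²` ON this family for `w ∈ {.05, .10, .15, .16, .1666}`,
i.e. the bound of `margerinMargin_le` is conjecturally the exact margin `σ(c)`.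
The statements are def-free: the `let`s are verbatim the bodies of the skeleton's `scal`, `pairing`,
`rmNormSq`, `devNormSq`, `margerinP2`, `margerinCone` (this file declares no definition).

## References

* C. Margerin, *A sharp characterization of the smooth 4-sphere in curvature terms*, Comm. Anal.
  Geom. 6 (1998) 21–65: Part I, Prop. 4 (p. 27), Lemma 5 (p. 29), Lemmas 8–9 (pp. 33–35).
  [Margerin1998]
* R. S. Hamilton, *Four-manifolds with positive curvature operator*, J. Differential Geom. 24
  (1986) 153–179, §6 p. 166 (the block system). [Hamilton1986]
* S.-Y. A. Chang, M. J. Gursky, P. C. Yang, *A conformally invariant sphere theorem in four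
  dimensions*, Publ. Math. IHÉS 98 (2003) 105–143, p. 106. [ChangGurskyYang2003]
-/

noncomputable section

open scoped Matrix BigOperators
open Literature.Geometry.Riemannian

namespace Summit.SmoothPoincare4.SmoothPoincare4.Theorems.ChangGurskyYang.Negative

set_option linter.dupNamespace false

/-- `(t·1)^# = t²·1` for `3 × 3` matrices (the cofactor matrix is quadratic). [folklore] -/
theorem sharp_smul_one_fin_three (t : ℝ) :
    (t • (1 : Matrix (Fin 3) (Fin 3) ℝ)).sharp = (t ^ 2) • (1 : Matrix (Fin 3) (Fin 3) ℝ) := by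
  ext i j
  fin_cases i <;> fin_cases j <;>
    simp [Matrix.sharp, Matrix.adjugate_fin_three, Matrix.smul_apply] <;> ring

/-- **Hamilton's ODE on the `S³ × ℝ` family**: `field (1, t·1, 1) = ((3 + t²)·1, (2t + 2t²)·1, (3 + t²)·1)`.
[cite: Hamilton1986, §6, p. 166] -/
theorem field_cylinderFamily (t : ℝ) :
    HamiltonODE.field ((1 : Matrix (Fin 3) (Fin 3) ℝ), t • (1 : Matrix (Fin 3) (Fin 3) ℝ),
        (1 : Matrix (Fin 3) (Fin 3) ℝ)) =
      ((3 + t ^ 2) • (1 : Matrix (Fin 3) (Fin 3) ℝ), (2 * t + 2 * t ^ 2) • (1 : Matrix (Fin 3) (Fin 3) ℝ),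
        (3 + t ^ 2) • (1 : Matrix (Fin 3) (Fin 3) ℝ)) := by
  simp only [HamiltonODE.field]
  rw [sharp_smul_one_fin_three]
  have h1 : (1 : Matrix (Fin 3) (Fin 3) ℝ).sharp = 1 := by simp [Matrix.sharp]
  rw [h1]
  refine Prod.ext ?_ (Prod.ext ?_ ?_)
  · ext i j
    fin_cases i <;> fin_cases j <;>
      simp [Matrix.smul_apply] <;> ring
  · ext i j
    fin_cases i <;> fin_cases j <;>
      simp [Matrix.smul_apply] <;> ring
  · ext i j
    fin_cases i <;> fin_cases j <;>
      simp [Matrix.smul_apply] <;> ring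

/-- **The margin of `stub_margerinPolynomial` is at most `2(1 - t)²/(3 + t²)` on the cone `c = t²/6`.**
The hypothesis is the stub's inequality `margerinP2 p ≤ -(σ · (devNormSq p · scal (field p)))` for all
`p ∈ margerinCone (t²/6)`, with the skeleton's definitions unfolded; the witness is `p_t = (1, t·1, 1)`
(`P₂ = -72t²(1-t)²`, `|𝒟|² R' = 6t²(18 + 6t²)`). [cite: Margerin1998, Part I, Prop. 4 and Lemma 9] -/
theorem margerinMargin_le (t σ : ℝ) (ht0 : 0 < t)
    (h : ∀ p : HamiltonODE.Blocks,
      let q : HamiltonODE.Blocks := HamiltonODE.field p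
      let scal : ℝ := p.1.trace + p.2.2.trace
      let scal' : ℝ := q.1.trace + q.2.2.trace
      let pairing : ℝ := (∑ i, ∑ j, p.1 i j * q.1 i j) + 2 * (∑ i, ∑ j, p.2.1 i j * q.2.1 i j) +
        ∑ i, ∑ j, p.2.2 i j * q.2.2 i j
      let rmNormSq : ℝ := (∑ i, ∑ j, p.1 i j ^ 2) + 2 * (∑ i, ∑ j, p.2.1 i j ^ 2) +
        ∑ i, ∑ j, p.2.2 i j ^ 2
      let devNormSq : ℝ := rmNormSq - scal ^ 2 / 6
      let margerinP2 : ℝ := scal * (2 * pairing - scal * scal' / 3) - 2 * devNormSq * scal'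
      p.1.IsSymm → p.2.2.IsSymm → p.1.trace = p.2.2.trace → 0 ≤ scal →
        devNormSq ≤ t ^ 2 / 6 * scal ^ 2 → margerinP2 ≤ -(σ * (devNormSq * scal'))) :
    σ ≤ 2 * (1 - t) ^ 2 / (3 + t ^ 2) := by
  have key := h ((1 : Matrix (Fin 3) (Fin 3) ℝ), t • (1 : Matrix (Fin 3) (Fin 3) ℝ),
    (1 : Matrix (Fin 3) (Fin 3) ℝ))
  dsimp only at key
  rw [field_cylinderFamily] at key
  simp [Matrix.trace, Matrix.smul_apply, Matrix.one_apply, Matrix.isSymm_one] at key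
  have ht2 : 0 < t ^ 2 := by positivity
  have key2 := key (by linarith)
  rw [le_div_iff₀ (by positivity)]
  nlinarith [key2, ht2, mul_pos ht2 ht2]

/-- **No margin on the sharp cone**: at `c = 1/6` (`t = 1`) the stub's inequality admits no `σ > 0`
(the round cylinder `(1, 1, 1)` has `P₂ = 0` but `|𝒟|²·R' = 6·24 > 0`). [cite: Margerin1998, Part I, Prop. 4] -/
theorem no_margerinMargin_at_sixth (σ : ℝ) (hσ : 0 < σ) :
    ¬ (∀ p : HamiltonODE.Blocks,
      let q : HamiltonODE.Blocks := HamiltonODE.field p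
      let scal : ℝ := p.1.trace + p.2.2.trace
      let scal' : ℝ := q.1.trace + q.2.2.trace
      let pairing : ℝ := (∑ i, ∑ j, p.1 i j * q.1 i j) + 2 * (∑ i, ∑ j, p.2.1 i j * q.2.1 i j) +
        ∑ i, ∑ j, p.2.2 i j * q.2.2 i j
      let rmNormSq : ℝ := (∑ i, ∑ j, p.1 i j ^ 2) + 2 * (∑ i, ∑ j, p.2.1 i j ^ 2) +
        ∑ i, ∑ j, p.2.2 i j ^ 2
      let devNormSq : ℝ := rmNormSq - scal ^ 2 / 6
      let margerinP2 : ℝ := scal * (2 * pairing - scal * scal' / 3) - 2 * devNormSq * scal'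
      p.1.IsSymm → p.2.2.IsSymm → p.1.trace = p.2.2.trace → 0 ≤ scal →
        devNormSq ≤ 1 / 6 * scal ^ 2 → margerinP2 ≤ -(σ * (devNormSq * scal'))) := by
  intro h
  have := margerinMargin_le 1 σ one_pos (by simpa using h)
  norm_num at this
  linarith

/-- **The margin is always `< 2/3`**: on every cone `c > 0` any admissible `σ` satisfies `σ < 2/3`
(take `t = min 1 √(6c)`-small members of the family; here: the sub-family with `t² / 6 ≤ c` suffices,
and already `t = min 1 (6c)`… we use `t := min 1 c`, which lies in the cone since `t²/6 ≤ c`).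
[cite: Margerin1998, Part I, Lemma 8] -/
theorem margerinMargin_lt_twoThirds (c σ : ℝ) (hc : 0 < c)
    (h : ∀ p : HamiltonODE.Blocks,
      let q : HamiltonODE.Blocks := HamiltonODE.field p
      let scal : ℝ := p.1.trace + p.2.2.trace
      let scal' : ℝ := q.1.trace + q.2.2.trace
      let pairing : ℝ := (∑ i, ∑ j, p.1 i j * q.1 i j) + 2 * (∑ i, ∑ j, p.2.1 i j * q.2.1 i j) +
        ∑ i, ∑ j, p.2.2 i j * q.2.2 i j
      let rmNormSq : ℝ := (∑ i, ∑ j, p.1 i j ^ 2) + 2 * (∑ i, ∑ j, p.2.1 i j ^ 2) +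
        ∑ i, ∑ j, p.2.2 i j ^ 2
      let devNormSq : ℝ := rmNormSq - scal ^ 2 / 6
      let margerinP2 : ℝ := scal * (2 * pairing - scal * scal' / 3) - 2 * devNormSq * scal'
      p.1.IsSymm → p.2.2.IsSymm → p.1.trace = p.2.2.trace → 0 ≤ scal →
        devNormSq ≤ c * scal ^ 2 → margerinP2 ≤ -(σ * (devNormSq * scal'))) :
    σ < 2 / 3 := by
  -- the family member with `t = min 1 c` lies in the cone `c` (its weak pinching is `t²/6 ≤ t/6 ≤ c`)
  set t : ℝ := min 1 c with ht
  have ht0 : 0 < t := lt_min one_pos hc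
  have ht1 : t ≤ 1 := min_le_left _ _
  have htc : t ≤ c := min_le_right _ _
  have hsub : t ^ 2 / 6 ≤ c := by nlinarith
  have hle := margerinMargin_le t σ ht0 (fun p h1 h2 h3 h4 h5 ↦ h p h1 h2 h3 h4
    (h5.trans (by
      have : 0 ≤ (p.1.trace + p.2.2.trace) ^ 2 := sq_nonneg _
      nlinarith)))
  have ht2 : 0 < t ^ 2 := by positivity
  rw [le_div_iff₀ (by positivity)] at hle
  nlinarith [hle, ht2]

/-- **Hamilton's ODE on the Fubini–Study family**:
`field (diag(1+2s, 1−s, 1−s), 0, 1) = (diag(3+6s², 3−3s², 3−3s²), 0, 3·1)`. [cite: Hamilton1986, §6, p. 166] -/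
theorem field_fubiniStudyFamily (s : ℝ) :
    HamiltonODE.field ((!![1 + 2 * s, 0, 0; 0, 1 - s, 0; 0, 0, 1 - s] : Matrix (Fin 3) (Fin 3) ℝ),
        (0 : Matrix (Fin 3) (Fin 3) ℝ), (1 : Matrix (Fin 3) (Fin 3) ℝ)) =
      ((!![3 + 6 * s ^ 2, 0, 0; 0, 3 - 3 * s ^ 2, 0; 0, 0, 3 - 3 * s ^ 2] : Matrix (Fin 3) (Fin 3) ℝ),
        (0 : Matrix (Fin 3) (Fin 3) ℝ), (3 : ℝ) • (1 : Matrix (Fin 3) (Fin 3) ℝ)) := by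
  simp only [HamiltonODE.field]
  have h1 : (1 : Matrix (Fin 3) (Fin 3) ℝ).sharp = 1 := by simp [Matrix.sharp]
  refine Prod.ext ?_ (Prod.ext ?_ ?_)
  · ext i j
    fin_cases i <;> fin_cases j <;>
      simp [Matrix.sharp, Matrix.adjugate_fin_three] <;> ring
  · ext i j
    fin_cases i <;> fin_cases j <;> simp [Matrix.sharp]
  · rw [h1]
    ext i j
    fin_cases i <;> fin_cases j <;> simp [Matrix.smul_apply] <;> ring

/-- **Weak pinching increases just outside the `1/6`-cone**: for every `c > 1/6` there is a block triple
on the Bianchi locus with `R = 6`, `|𝒟|² ≤ c R²` and `P₂ > 0` — namely `q_s`, `s = 12c/(1+6c) ∈ (1, √(6c)]`,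
where `P₂ = 216 s²(s−1)`. [cite: Margerin1998, Part V, p. 48] [cite: ChangGurskyYang2003, p. 106] -/
theorem margerinP2_pos_above_sixth (c : ℝ) (hc : 1 / 6 < c) :
    ∃ p : HamiltonODE.Blocks,
      let q : HamiltonODE.Blocks := HamiltonODE.field p
      let scal : ℝ := p.1.trace + p.2.2.trace
      let scal' : ℝ := q.1.trace + q.2.2.trace
      let pairing : ℝ := (∑ i, ∑ j, p.1 i j * q.1 i j) + 2 * (∑ i, ∑ j, p.2.1 i j * q.2.1 i j) +
        ∑ i, ∑ j, p.2.2 i j * q.2.2 i j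
      let rmNormSq : ℝ := (∑ i, ∑ j, p.1 i j ^ 2) + 2 * (∑ i, ∑ j, p.2.1 i j ^ 2) +
        ∑ i, ∑ j, p.2.2 i j ^ 2
      let devNormSq : ℝ := rmNormSq - scal ^ 2 / 6
      let margerinP2 : ℝ := scal * (2 * pairing - scal * scal' / 3) - 2 * devNormSq * scal'
      p.1.IsSymm ∧ p.2.2.IsSymm ∧ p.1.trace = p.2.2.trace ∧ 0 < scal ∧
        devNormSq ≤ c * scal ^ 2 ∧ 0 < margerinP2 := by
  set s : ℝ := 12 * c / (1 + 6 * c) with hs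
  have hden : 0 < 1 + 6 * c := by linarith
  have hs1 : 1 < s := by rw [hs, lt_div_iff₀ hden]; linarith
  have hs2 : s ^ 2 ≤ 6 * c := by
    rw [hs, div_pow, div_le_iff₀ (by positivity)]
    nlinarith [sq_nonneg (1 - 6 * c)]
  refine ⟨((!![1 + 2 * s, 0, 0; 0, 1 - s, 0; 0, 0, 1 - s] : Matrix (Fin 3) (Fin 3) ℝ),
    (0 : Matrix (Fin 3) (Fin 3) ℝ), (1 : Matrix (Fin 3) (Fin 3) ℝ)), ?_⟩
  dsimp only
  rw [field_fubiniStudyFamily]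
  refine ⟨?_, Matrix.isSymm_one, ?_, ?_, ?_, ?_⟩
  · -- a diagonal matrix is symmetric
    ext i j
    fin_cases i <;> fin_cases j <;> simp
  · simp [Matrix.trace, Fin.sum_univ_three]
    ring
  · simp [Matrix.trace, Fin.sum_univ_three]
    linarith
  · simp [Matrix.trace, Fin.sum_univ_three, Matrix.one_apply]
    nlinarith [hs2]
  · simp [Matrix.trace, Fin.sum_univ_three, Matrix.one_apply, Matrix.smul_apply]
    nlinarith [hs1, mul_pos (zero_lt_one.trans hs1) (zero_lt_one.trans hs1)]

/-- **No version of `stub_margerinPolynomial` above the sharp opening**: for `c > 1/6` and any `σ ≥ 0`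
the margin inequality fails on the cone `WP ≤ c`. [cite: Margerin1998, Part I, Prop. 4; Thm. 2] -/
theorem no_margerinMargin_above_sixth (c σ : ℝ) (hc : 1 / 6 < c) (hσ : 0 ≤ σ) :
    ¬ (∀ p : HamiltonODE.Blocks,
      let q : HamiltonODE.Blocks := HamiltonODE.field p
      let scal : ℝ := p.1.trace + p.2.2.trace
      let scal' : ℝ := q.1.trace + q.2.2.trace
      let pairing : ℝ := (∑ i, ∑ j, p.1 i j * q.1 i j) + 2 * (∑ i, ∑ j, p.2.1 i j * q.2.1 i j) +
        ∑ i, ∑ j, p.2.2 i j * q.2.2 i j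
      let rmNormSq : ℝ := (∑ i, ∑ j, p.1 i j ^ 2) + 2 * (∑ i, ∑ j, p.2.1 i j ^ 2) +
        ∑ i, ∑ j, p.2.2 i j ^ 2
      let devNormSq : ℝ := rmNormSq - scal ^ 2 / 6
      let margerinP2 : ℝ := scal * (2 * pairing - scal * scal' / 3) - 2 * devNormSq * scal'
      p.1.IsSymm → p.2.2.IsSymm → p.1.trace = p.2.2.trace → 0 ≤ scal →
        devNormSq ≤ c * scal ^ 2 → margerinP2 ≤ -(σ * (devNormSq * scal'))) := by
  intro h
  set s : ℝ := 12 * c / (1 + 6 * c) with hs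
  have hden : 0 < 1 + 6 * c := by linarith
  have hs1 : 1 < s := by rw [hs, lt_div_iff₀ hden]; linarith
  have hs2 : s ^ 2 ≤ 6 * c := by
    rw [hs, div_pow, div_le_iff₀ (by positivity)]
    nlinarith [sq_nonneg (1 - 6 * c)]
  have hsymm : ((!![1 + 2 * s, 0, 0; 0, 1 - s, 0; 0, 0, 1 - s] : Matrix (Fin 3) (Fin 3) ℝ)).IsSymm := by
    ext i j
    fin_cases i <;> fin_cases j <;> simp
  have key := h ((!![1 + 2 * s, 0, 0; 0, 1 - s, 0; 0, 0, 1 - s] : Matrix (Fin 3) (Fin 3) ℝ),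
    (0 : Matrix (Fin 3) (Fin 3) ℝ), (1 : Matrix (Fin 3) (Fin 3) ℝ)) hsymm Matrix.isSymm_one
  dsimp only at key
  rw [field_fubiniStudyFamily] at key
  simp [Matrix.trace, Fin.sum_univ_three, Matrix.one_apply, Matrix.smul_apply] at key
  have hs0 : 0 < s := zero_lt_one.trans hs1
  have key2 := key (by ring) (by linarith) (by nlinarith [hs2])
  -- key2 : P₂(q_s) = 216 s²(s-1) ≤ -σ·(6s²·18); but the left side is positive and the right side ≤ 0
  nlinarith [key2, mul_pos (mul_pos hs0 hs0) (sub_pos.2 hs1), mul_nonneg hσ (sq_nonneg s)]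

end Summit.SmoothPoincare4.SmoothPoincare4.Theorems.ChangGurskyYang.Negative

end
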